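import Literature.NumberTheory.EllipticCurves.IwasawaAlgebraRankOneIdealProofs
import Literature.NumberTheory.EllipticCurves.IwasawaAlgebraProofs
import HarnessLib

/-!
# STUB-IDEAS k1 (gen 5) — `stub_heegnerIndexLowerAtTwo` of crux `PrintCf2.SplitBadTwoLowerHalfOfFacts`
# (stmt-BirchSwinnertonDyer-27851): typed sketch of the proposed step
# «twist dissolution at 𝔭̄-level 3 + restriction-before-quotient ⇒ the LOWER local brick R2c⁻ from print»

Planner seat `sidea-stub_heegnerIndexLowerAtTwo-1-g5`, technique = weaken / strengthen (weakest sufficient form).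
This file only TYPES (and, where cheap, PROVES) the helper lemmas of the idea card
`Ideas/stub_heegnerIndexLowerAtTwo-k1.md` (gen 5). PROVED here: the bookkeeping lemma
`charIdeal_ker_factor_le_span` («R2c⁻ from integrality of the measure + pseudo-null cokernel of the Coleman map»),
the coinvariant-injectivity lemma `coinvariants_injective_of_noFixedPoints` (de Shalit I.3.8's mechanism), the
left-exactness lemma `invariants_coker_injective` and the per-key cokernel table `card_fixed_mul_zmod8`. `sorry` appears
only in the helper stub `H_coinvRightExact` (size S, standard right-exactness of coinvariants).
Nothing here closes a stub, a crux or a route; BSD is not proved by any of this.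

Dictionary (road T1⁻/R2c, lower half at `p = 2`, W = 49a^{(d)} with `4 ∣ d_K`): `R = 𝒪̂_nr⟦Γ⟧` (or `ℤ₂⟦T⟧`) the
one-variable algebra of the line after the `Δ`/`H_d`-descent; `V = i_d(U_𝔭̄(F_∞) ⊗̂ 𝒪) ⊆ R` the image of the semi-local
units at `v̄ = 𝔭̄` along the `𝔭`-tower under the RESTRICTED two-variable Coleman map `i_d` (de Shalit I.3.7 (13)/(17),
restricted by coinvariants under `A = Gal(ℚ₂^ab/ℚ₂(ζ₈)^{nr})` and invariants under `H_d ⊂ (ℤ/8)^×`, `#H_d = 2`);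
`I = i_d(C̄) ⊆ V` the image of the elliptic units; `μ = μ_d` = the `χ_d`-branch of de Shalit's integral measure
`μ_𝔤` (II.4.12) restricted to the line; `R ⧸ V` pseudo-null because `coker i_d ↪ ((𝒪/8)(1))^{H_d}` is finite.
-/

noncomputable section

open scoped Classical

set_option autoImplicit false
set_option linter.dupNamespace false

open Literature.NumberTheory.EllipticCurves

namespace Summit.BirchSwinnertonDyer.BirchSwinnertonDyer.Cruxes.SplitBadTwoLowerHalfOfFacts.StubIdeasK1G5

/-! ## §1 R2c⁻ — the WEAKEST SUFFICIENT local brick for LOWER, as pure commutative algebra (PROVED) -/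

section Bookkeeping

variable {R : Type*} [CommRing R] [IsNoetherianRing R] [IsDomain R]

omit [IsNoetherianRing R] in
/-- `R ⧸ J` is a torsion `R`-module as soon as `J ≠ 0` (any `0 ≠ s ∈ J` kills it). -/
theorem isTorsion_quotient_of_ne_bot {J : Ideal R} (hJ : J ≠ ⊥) : Module.IsTorsion R (R ⧸ J) := by
  obtain ⟨s, hsJ, hs0⟩ := (Submodule.ne_bot_iff J).mp hJ
  intro x
  obtain ⟨r, rfl⟩ := Submodule.Quotient.mk_surjective J x
  refine ⟨⟨s, mem_nonZeroDivisors_of_ne_zero hs0⟩, ?_⟩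
  rw [Submonoid.mk_smul, ← Submodule.Quotient.mk_smul, Submodule.Quotient.mk_eq_zero, smul_eq_mul]
  exact Ideal.mul_mem_right r J hsJ

/-- Multiplicativity of `char` along `0 → J'/J → R/J → R/J' → 0` for ideals `0 ≠ J ≤ J'`; the middle module
`J'/J` is realised as `ker (R ⧸ J ↠ R ⧸ J')`. Uses the tree's general
`Literature.NumberTheory.EllipticCurves.Module.charIdeal_eq_mul_of_exact` (Bourbaki AC VII §4.5 Prop. 10). -/
theorem charIdeal_quotient_eq_mul {J J' : Ideal R} (h : J ≤ J') (hJ : J ≠ ⊥) :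
    Module.charIdeal R (R ⧸ J) =
      Module.charIdeal R (LinearMap.ker (Submodule.factor h)) * Module.charIdeal R (R ⧸ J') :=
  Module.charIdeal_eq_mul_of_exact (isTorsion_quotient_of_ne_bot hJ)
    (LinearMap.ker (Submodule.factor h)).subtype (Submodule.factor h)
    (Submodule.injective_subtype _) (Submodule.factor_surjective h) (LinearMap.exact_subtype_ker_map _)

/-- **R2c⁻ (bookkeeping form, PROVED).** Let `i : U ↪ R` be an injective `R`-linear map with PSEUDO-NULL
cokernel (`R ⧸ V`, `V = i(U)`), `C̄ ⊆ U` with image `I = i(C̄) ≠ 0`, and suppose INTEGRALITY `I ⊆ (μ)`, `μ ≠ 0`.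
Then `char_R(U/C̄) = char_R(V/I) ⊆ (μ)`, i.e. **`μ ∣ char(U/C̄)`** — the only direction the LOWER bound consumes.
Here `V/I` is realised as `ker (R ⧸ I ↠ R ⧸ V)`. No equality `i(C̄) = (μ)`, no computation of `coker i`, no
`p ∤ #Δ` is used: every unit-side imprimitivity (the factor `12`, the ideal `𝒥 = ⟨σ_𝔞 − N𝔞⟩`, extra Euler factors,
the finite `coker i_d ⊆ ((𝒪/8)(1))^{H_d}`) only enlarges the right-hand side and is discarded. -/
theorem charIdeal_ker_factor_le_span [UniqueFactorizationMonoid R] {I V : Ideal R} (hIV : I ≤ V) (hI : I ≠ ⊥)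
    {μ : R} (hμ : μ ≠ 0) (hIμ : I ≤ Ideal.span {μ}) (hV : Module.IsPseudoNull R (R ⧸ V)) :
    Module.charIdeal R (LinearMap.ker (Submodule.factor hIV)) ≤ Ideal.span {μ} := by
  have h1 := charIdeal_quotient_eq_mul hIV hI
  rw [Module.charIdeal_eq_top_of_isPseudoNull hV, Ideal.mul_top] at h1
  have h2 := charIdeal_quotient_eq_mul hIμ hI
  rw [Module.charIdeal_quotient_span_singleton hμ] at h2
  rw [← h1, h2]
  exact Ideal.mul_le_left

/-- The same lemma with the integrality hypothesis in de Shalit's imprimitive shape `i(C̄) ⊆ (c • μ)` (`c = 12`, or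
`c ∈ 𝒥`): still `char(U/C̄) ⊆ (μ)` — the imprimitivity constant is HARMLESS for LOWER. -/
theorem charIdeal_ker_factor_le_span_of_le_mul [UniqueFactorizationMonoid R] {I V : Ideal R} (hIV : I ≤ V)
    (hI : I ≠ ⊥) {μ c : R} (hμ : μ ≠ 0) (hIμ : I ≤ Ideal.span {c * μ}) (hV : Module.IsPseudoNull R (R ⧸ V)) :
    Module.charIdeal R (LinearMap.ker (Submodule.factor hIV)) ≤ Ideal.span {μ} :=
  charIdeal_ker_factor_le_span hIV hI hμ
    (hIμ.trans (Ideal.span_singleton_le_span_singleton.mpr (Dvd.intro_left c rfl))) hV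

end Bookkeeping

/-! ## §2 Restriction BEFORE quotient — de Shalit I.3.8's mechanism as a diagram chase (PROVED) -/

section Coinvariants

variable {A : Type*} [CommRing A] {X Y Z : Type*} [AddCommGroup X] [Module A X] [AddCommGroup Y] [Module A Y]
  [AddCommGroup Z] [Module A Z]

/-- **Coinvariants stay left exact when the right-hand term has no fixed points.** For a short exact sequence
`0 → X →f Y →g Z` with commuting endomorphisms `σ_X, σ_Y, σ_Z` (a topological generator of the pro-cyclic group
`A = Gal(ℚ₂^ab/𝓚_{3,∞})` acting on de Shalit's (17): `0 → Gal(M(k^ab)/k^ab) ⊗̂ 𝒪 → Λ(𝒢_a, 𝒪) → 𝒪(1) → 0`), if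
`σ_Z` has no non-zero fixed vector (`𝒪(1)^A = 0`: `𝓚_{3,∞} ∌ μ_{16}`), then `X_A → Y_A` is injective, i.e.
`f x ∈ (σ_Y − 1)Y ⇒ x ∈ (σ_X − 1)X`. This is the step giving `(13)₃ : 0 → 𝒰₃ ⊗̂ 𝒪 → 𝒪[(ℤ/8)^×]⟦Γ⟧ → (𝒪/8)(1) → 0`
for the tower `ℚ₂(ζ₈)·ℚ₂^{(2^∞)}` exactly as de Shalit I.3.8 does it for `⟨α⟩`. -/
theorem coinvariants_injective_of_noFixedPoints (f : X →ₗ[A] Y) (g : Y →ₗ[A] Z)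
    (hf : Function.Injective f) (hfg : Function.Exact f g)
    (σX : X →ₗ[A] X) (σY : Y →ₗ[A] Y) (σZ : Z →ₗ[A] Z)
    (hXY : f ∘ₗ σX = σY ∘ₗ f) (hYZ : g ∘ₗ σY = σZ ∘ₗ g)
    (hZ : ∀ z : Z, σZ z = z → z = 0) :
    ∀ x : X, f x ∈ LinearMap.range (σY - LinearMap.id) → x ∈ LinearMap.range (σX - LinearMap.id) := by
  intro x hx
  obtain ⟨y, hy⟩ := LinearMap.mem_range.mp hx
  -- `g y` is a fixed point of `σ_Z`, hence zero
  have hgy : g y = 0 := by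
    apply hZ
    have h0 : g ((σY - LinearMap.id : Y →ₗ[A] Y) y) = 0 := by rw [hy]; exact hfg.apply_apply_eq_zero x
    have h1 : g (σY y) = σZ (g y) := LinearMap.congr_fun hYZ y
    rw [LinearMap.sub_apply, LinearMap.id_apply, map_sub, h1, sub_eq_zero] at h0
    exact h0
  -- so `y = f x'`
  obtain ⟨x', rfl⟩ := (hfg y).mp hgy
  refine LinearMap.mem_range.mpr ⟨x', hf ?_⟩
  have h2 : f (σX x') = σY (f x') := LinearMap.congr_fun hXY x'
  rw [LinearMap.sub_apply, LinearMap.id_apply, map_sub, h2, ← hy, LinearMap.sub_apply, LinearMap.id_apply]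

end Coinvariants

/-! ## §3 Per-key finite defect: `((𝒪/8)(1))^{H_d}` (PROVED by `decide`) -/

/-- The cokernel of the restricted Coleman map `i_d` embeds into `((𝒪/8)(1))^{H_d}`, whose size over `ℤ/8` is the
number of `x ∈ ℤ/8` fixed by multiplication by the non-trivial element `h ∈ H_d ⊂ (ℤ/8)^×`:
`h = 5` (keys `d ∈ {−1, 3}`): 4; `h = 7` (keys `d ∈ {2, 10}`): 2; `h = 3` (keys `d ∈ {−2, 6}`): 2.
So the restriction defect is an explicit finite group of order `≤ 4` per key — pseudo-null, hence invisible to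
`char` (this is all `charIdeal_ker_factor_le_span` needs from it). -/
theorem card_fixed_mul_zmod8 :
    (Finset.univ.filter (fun x : ZMod 8 => (5 : ZMod 8) * x = x)).card = 4 ∧
    (Finset.univ.filter (fun x : ZMod 8 => (7 : ZMod 8) * x = x)).card = 2 ∧
    (Finset.univ.filter (fun x : ZMod 8 => (3 : ZMod 8) * x = x)).card = 2 := by
  decide

/-- The three subgroups `H_d = {1, h} ⊂ (ℤ/8)^×` are exactly the order-two subgroups, and `(ℤ/8)^×` is killed by 2:
so `Gal(ℚ₂(ζ₈)/ℚ₂) ≅ (ℤ/8)^×` has exactly three quadratic subfields-of-index-2 … the arithmetic input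
«`ℚ₂(ζ₈)·ℚ₂^{nr} ⊇ ℚ₂(√d)` for every `d`» is LCFT (norm group `(ℚ₂^×)²·⟨π²⟩`), recorded in the card, not here. -/
theorem units_zmod8_exponent_two : ∀ u : (ZMod 8)ˣ, u * u = 1 := by
  decide

/-! ## §4 Units of the line = `H_d`-invariants; the restriction defect is bounded by `Q^{H}` (PROVED: invariants
are left exact) and the cokernel of the coinvariant sequence (helper stub, S) -/

section Invariants

variable {S : Type*} [CommRing S] {U L Q : Type*} [AddCommGroup U] [Module S U] [AddCommGroup L] [Module S L]
  [AddCommGroup Q] [Module S Q]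

/-- **Units of a subfield are the invariants, and invariants are left exact.** For `0 → U →i L →q Q` exact with
commuting endomorphisms (`τ` = the non-trivial element of `H_d`, acting on `(13)₃`), every `τ`-invariant `l ∈ L`
with `q l = 0` comes from a `τ`-invariant of `U`. Hence `coker(U^{H_d} → L^{H_d}) ↪ Q^{H_d}`: with
`U = 𝒰₃ ⊗̂ 𝒪`, `L = 𝒪[(ℤ/8)^×]⟦Γ⟧`, `Q = (𝒪/8)(1)` this is «`coker i_d` is finite of order `≤ #((𝒪/8)(1))^{H_d}`»
(`card_fixed_mul_zmod8`), and `U^{H_d} = U_𝔭̄(F_∞) ⊗̂ 𝒪` because `F_{∞,v̄} = 𝓚_{3,∞}^{H_d}` (twist dissolution). -/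
theorem invariants_coker_injective (i : U →ₗ[S] L) (q : L →ₗ[S] Q) (hi : Function.Injective i)
    (hiq : Function.Exact i q) (τU : U →ₗ[S] U) (τL : L →ₗ[S] L) (hUL : i ∘ₗ τU = τL ∘ₗ i) :
    ∀ l : L, τL l = l → q l = 0 → ∃ u : U, τU u = u ∧ i u = l := by
  intro l hl hql
  obtain ⟨u, rfl⟩ := (hiq l).mp hql
  refine ⟨u, hi ?_, rfl⟩
  have h := LinearMap.congr_fun hUL u
  rw [LinearMap.comp_apply, LinearMap.comp_apply] at h
  rw [h, hl]

/-- **H_coinvRightExact (helper stub, size S; standard).** Coinvariants are right exact: for `U →i L →q Q → 0`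
exact with commuting endomorphisms `σ`, the induced sequence `U_σ → L_σ → Q_σ → 0` is exact at `L_σ`; elementwise:
if `q l ∈ (σ_Q − 1)Q` then `l ∈ i(U) + (σ_L − 1)L`. Together with `coinvariants_injective_of_noFixedPoints` this
turns de Shalit's (17) into `(13)₃ : 0 → 𝒰₃ ⊗̂ 𝒪 → 𝒪[(ℤ/8)^×]⟦Γ⟧ → (𝒪/8)(1) → 0` (cokernel `𝒪(1)_A = 𝒪(1)/(9 − 1)`). -/
theorem H_coinvRightExact (i : U →ₗ[S] L) (q : L →ₗ[S] Q) (hq : Function.Surjective q)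
    (hiq : Function.Exact i q) (σL : L →ₗ[S] L) (σQ : Q →ₗ[S] Q) (hLQ : q ∘ₗ σL = σQ ∘ₗ q) :
    ∀ l : L, q l ∈ LinearMap.range (σQ - LinearMap.id) →
      l ∈ LinearMap.range i ⊔ LinearMap.range (σL - LinearMap.id) := by
  sorry

end Invariants

end Summit.BirchSwinnertonDyer.BirchSwinnertonDyer.Cruxes.SplitBadTwoLowerHalfOfFacts.StubIdeasK1G5

end
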